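import Summits.HodgeConjecture.CorCM.MumfordTateRankSevenSplit
import Literature.AlgebraicGeometry.Motives.AbelianVarietySimpleFactorsUnique
import HarnessLib

/-!
# The rung `dim MT(H¹(X)) = 7` with DECOMPOSABLE semisimple Hodge Lie algebra, II: the isogeny classification
# `X ∼ B₁^{a+1} × B₂^{b+1}` with `B₁ ≁ B₂` non-CM elliptic curves or quaternion surfaces

COR-CM (cell `pub-hodgecm2`, seat `b27` gen 39, count-neutral lane MT-RANK-SEVEN-SPLIT; theorems only, no definition,
no named fact; UNCONDITIONAL — nothing here uses or asserts HC_CM).  Sequel of `CorCM/MumfordTateRankSevenSplit`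
(`X ∼ Y ⊞ Z` along the central idempotent `e`, `dim MT(H¹Y) = dim MT(H¹Z) = 4`, `Y`, `Z` not of CM type).

* §1 `hom_eq_zero_of_central_splitting` — for a CENTRAL idempotent `e ∈ End⁰(X)` with `F = h ≫ i`, `F = M e` in
  `End⁰(X)`, `i ≫ h = M`, `j ≫ t = M`, `i ≫ t = 0`, `j ≫ h = 0`: **`Hom(Y, Z) = 0 = Hom(Z, Y)`** (for `g : Y → Z` the
  endomorphism `u = h ≫ g ≫ j` has `F u = 0` and `u F = M u`, and `e` is central); `forall_hom_eq_zero_of_isIsogenous` —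
  orthogonality is an isogeny invariant (ranks of the finitely generated free `ℤ`-modules `Hom`, Mumford §19 Thm. 3);
  `forall_hom_eq_zero_of_biproduct` — and passes to the factors of constant biproducts.
* §2 **`exists_isIsogenous_powSucc_prod_powSucc_of_ideal_pair`** — for a complex abelian variety `X` whose Hodge Lie algebra
  is the sum of two commuting three-dimensional ideals `𝔞 ⊕ 𝔟` (neither inside `End_Hdg(H¹X)`):
  **`X ∼ B₁^{a+1} × B₂^{b+1}`** with `B₁`, `B₂` SIMPLE, NOT of CM type, `0 < dim Bᵢ ≤ 2`, `dim_ℚ End⁰(Bᵢ) = (dim Bᵢ)²`,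
  `Z(End⁰ Bᵢ) = ℚ` (non-CM elliptic curves or quaternion surfaces), `Hom(B₁, B₂) = 0 = Hom(B₂, B₁)` (so `B₁ ≁ B₂`),
  `(a+1) dim B₁ + (b+1) dim B₂ = dim X`, `dim MT(H¹X) = 7`, `X` not of CM type — Moonen–Zarhin's shapes with
  `Hg = Hg(B₁) × Hg(B₂)`, both factors forms of `SL₂` (1999, §3 (3.1) and Cor. (3.7) after Imai; Hazama 1989), obtained here
  from the Lie algebra: the rung `dim MT ≤ 4` of gen 30 (`exists_isIsogenous_power_of_not_isOfCMType`) applied to `Y` and `Z`.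

The Hodge-conjecture consequences are in `CorCM/MumfordTateRankSevenSplitHodge`.

## References

* [MoonenZarhin1999LowDim] B. Moonen, Yu. Zarhin, *Hodge classes on abelian varieties of low dimension*, Math. Ann.
  315 (1999), §2 (2.1)–(2.5), §3 (3.1), Thm. (3.2)(1), Cor. (3.7).
* [MumfordAV1970] D. Mumford, *Abelian Varieties* (1970), §19 Thm. 1, Cor. 1–2 (pp. 173–174), Thm. 3 (p. 176).
* [Milne1986AbelianVarieties] J. S. Milne, *Abelian varieties*, in Cornell–Silverman (1986), §12 p. 122.
* [Deligne1982HodgeCycles] P. Deligne, *Hodge cycles on abelian varieties*, LNM 900 (1982), I §3 Prop. 3.4, §5 Prop. 5.1.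
-/

noncomputable section

open scoped TensorProduct
open CategoryTheory CategoryTheory.Limits Module

namespace Summit.HodgeConjecture.CorCM

open Literature.AlgebraicGeometry.Motives
open Literature.AlgebraicGeometry.Motives.AbelianVariety
open Literature.AlgebraicGeometry.Motives.HodgeStructure
open Literature.AlgebraicGeometry.HodgeTheory
open Literature.AlgebraicGeometry.ComplexMultiplication (bettiRep bettiRep_injective bettiRep_of
  isIsogenous_biproduct_powSucc)
open Literature.AlgebraicGeometry.Milne1999 (IsOfCMType isOfCMType_iff_of_isIsogenous isOfCMType_biprod_iff)

/-! ## §1 Orthogonality of the two parts -/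

section Orthogonal

variable {X Y Z : AbelianVariety ℂ}

/-- **`Hom(Y, Z) = 0` and `Hom(Z, Y) = 0` for the two parts of a splitting along a CENTRAL idempotent.**  Let
`e ∈ Z(End⁰ X)`, `F = h ≫ i` with `F = M e` in `End⁰(X)`, `i ≫ h = M 𝟙_Y`, `j ≫ t = M 𝟙_Z`, `i ≫ t = 0`, `j ≫ h = 0`,
`M ≠ 0`.  For `g : Y → Z` put `u = h ≫ g ≫ j ∈ End(X)`; then `u ≫ F = 0` (`j ≫ h = 0`) and `F ≫ u = M u` (`i ≫ h = M`),
while `e u = u e` in `End⁰(X)` (central) gives `F ≫ u = u ≫ F` in the torsion-free `End(X)`; so `M u = 0`, `u = 0`, and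
`M² g = i ≫ u ≫ t = 0`.  Symmetrically for `g : Z → Y`. [cite: MumfordAV1970, §19 Thm. 3 (p. 176) and Cor. 2 (p. 174)]
[cite: Milne1986AbelianVarieties, §12 p. 122 (PDF p. 189)] -/
theorem hom_eq_zero_of_central_splitting {e : X.endAlgebra} (hec : e ∈ Subalgebra.center ℚ X.endAlgebra) {M : ℕ}
    (hM : M ≠ 0) {F : X ⟶ X} {h : X ⟶ Y} {i : Y ⟶ X} {t : X ⟶ Z} {j : Z ⟶ X}
    (hFe : AbelianVariety.endAlgebra.of X F = algebraMap ℚ X.endAlgebra (M : ℚ) * e) (hhi : h ≫ i = F)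
    (hih : i ≫ h = M • 𝟙 Y) (hjt : j ≫ t = M • 𝟙 Z) (hit : i ≫ t = 0) (hjh : j ≫ h = 0) :
    (∀ g : Y ⟶ Z, g = 0) ∧ (∀ g : Z ⟶ Y, g = 0) := by
  -- `F` commutes with every endomorphism of `X` (it is `M e` with `e` central)
  have hFe' : AbelianVariety.endAlgebra.of X F = (M : ℚ) • e := by rw [hFe, Algebra.smul_def]
  have hFc : ∀ u : X ⟶ X, F ≫ u = u ≫ F := by
    intro u
    have hce : AbelianVariety.endAlgebra.of X (End.of u) * e = e * AbelianVariety.endAlgebra.of X (End.of u) :=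
      Subalgebra.mem_center_iff.1 hec _
    have h1 : AbelianVariety.endAlgebra.of X (End.of u) * AbelianVariety.endAlgebra.of X (End.of F) =
        AbelianVariety.endAlgebra.of X (End.of F) * AbelianVariety.endAlgebra.of X (End.of u) := by
      change AbelianVariety.endAlgebra.of X (End.of u) * AbelianVariety.endAlgebra.of X F =
        AbelianVariety.endAlgebra.of X F * AbelianVariety.endAlgebra.of X (End.of u)
      rw [hFe', mul_smul_comm, smul_mul_assoc, hce]
    rw [← map_mul, ← map_mul] at h1
    have h2 := AbelianVariety.endAlgebra.of_injective_of_charZero (A := X) h1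
    -- `End.of u * End.of F = F ≫ u`
    simp only [End.mul_def, End.of] at h2
    exact h2
  constructor
  · intro g
    set u : X ⟶ X := h ≫ g ≫ j with hu
    have h1 : F ≫ u = M • u := by
      rw [hu, ← hhi, Category.assoc, ← Category.assoc i h, hih, Preadditive.nsmul_comp, Category.id_comp,
        Preadditive.comp_nsmul]
    have h2 : u ≫ F = 0 := by
      rw [hu, ← hhi, Category.assoc, Category.assoc, ← Category.assoc j h, hjh, zero_comp, comp_zero, comp_zero]
    have hu0 : u = 0 := hom_eq_zero_of_nsmul_eq_zero hM (by rw [← h1, hFc, h2])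
    have h3 : i ≫ u ≫ t = (M * M) • g := by
      rw [hu, Category.assoc, Category.assoc, hjt, ← Category.assoc i h, hih, Preadditive.nsmul_comp, Category.id_comp,
        Preadditive.comp_nsmul, Category.comp_id, smul_smul]
    rw [hu0, zero_comp, comp_zero] at h3
    exact hom_eq_zero_of_nsmul_eq_zero (mul_ne_zero hM hM) h3.symm
  · intro g
    set u : X ⟶ X := t ≫ g ≫ i with hu
    have h1 : u ≫ F = M • u := by
      rw [hu, ← hhi, Category.assoc, Category.assoc, ← Category.assoc i h, hih, Preadditive.nsmul_comp, Category.id_comp,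
        Preadditive.comp_nsmul, Preadditive.comp_nsmul]
    have h2 : F ≫ u = 0 := by
      rw [hu, ← hhi, Category.assoc, ← Category.assoc i t, hit, zero_comp, comp_zero]
    have hu0 : u = 0 := hom_eq_zero_of_nsmul_eq_zero hM (by rw [← h1, ← hFc, h2])
    have h3 : j ≫ u ≫ h = (M * M) • g := by
      rw [hu, Category.assoc, Category.assoc, hih, ← Category.assoc j t, hjt, Preadditive.nsmul_comp, Category.id_comp,
        Preadditive.comp_nsmul, Category.comp_id, smul_smul]
    rw [hu0, zero_comp, comp_zero] at h3
    exact hom_eq_zero_of_nsmul_eq_zero (mul_ne_zero hM hM) h3.symm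

/-- **Orthogonality is an isogeny invariant**: if `Hom(Y, Z) = 0`, `Y ∼ Y'`, `Z ∼ Z'`, then `Hom(Y', Z') = 0` (the ranks of
the finitely generated torsion-free `ℤ`-modules `Hom` are isogeny invariants, `finrank_hom_eq_of_isIsogeny_left/right`).
[cite: MumfordAV1970, §19 Thm. 3 (p. 176)] -/
theorem forall_hom_eq_zero_of_isIsogenous {Y' Z' : AbelianVariety ℂ} (h0 : ∀ g : Y ⟶ Z, g = 0)
    (hY : IsIsogenous Y Y') (hZ : IsIsogenous Z Z') : ∀ g : Y' ⟶ Z', g = 0 := by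
  obtain ⟨u, hu⟩ := hY
  obtain ⟨v, hv⟩ := hZ
  haveI : Module.Finite ℤ (Y' ⟶ Z') := module_finite_hom_holds Y' Z'
  haveI := isTorsionFree_int_hom Y' Z'
  haveI : Subsingleton (Y ⟶ Z) := ⟨fun a b => by rw [h0 a, h0 b]⟩
  have h1 : Module.finrank ℤ (Y' ⟶ Z') = 0 := by
    rw [← finrank_hom_eq_of_isIsogeny_left hu Z', ← finrank_hom_eq_of_isIsogeny_right Y hv]
    exact Module.finrank_zero_of_subsingleton
  haveI := (Module.finrank_zero_iff (R := ℤ)).1 h1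
  exact fun g => Subsingleton.elim g 0

/-- **Orthogonality passes to the factors of constant biproducts**: `Hom(⨁_I B₁, ⨁_J B₂) = 0 ⟹ Hom(B₁, B₂) = 0`
(`f = ι ≫ (π ≫ f ≫ ι) ≫ π`). [cite: MumfordAV1970, §19 Cor. 2 (p. 174)] -/
theorem forall_hom_eq_zero_of_biproduct {B₁ B₂ : AbelianVariety ℂ} {I J : Type} [Fintype I] [Fintype J] (i₀ : I)
    (j₀ : J) (h0 : ∀ g : (⨁ fun _ : I => B₁) ⟶ (⨁ fun _ : J => B₂), g = 0) : ∀ f : B₁ ⟶ B₂, f = 0 := by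
  classical
  intro f
  have h := h0 (biproduct.π (fun _ : I => B₁) i₀ ≫ f ≫ biproduct.ι (fun _ : J => B₂) j₀)
  have h' := congrArg (fun g => biproduct.ι (fun _ : I => B₁) i₀ ≫ g ≫ biproduct.π (fun _ : J => B₂) j₀) h
  simpa only [Category.assoc, biproduct.ι_π_self_assoc, biproduct.ι_π_self, Category.comp_id, zero_comp, comp_zero]
    using h'

end Orthogonal

/-! ## §2 The isogeny classification -/

variable [HodgeTensorFacts.{0, 0}] {X : AbelianVariety ℂ} {n : ℕ}

/-- **`X ∼ B₁^{a+1} × B₂^{b+1}` for a complex abelian variety whose Hodge Lie algebra is the sum of two commuting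
three-dimensional ideals.**  Let `𝔞, 𝔟 ≤ Lie Hg(H¹X)` be ideals commuting elementwise, `Lie Hg(H¹X) ≤ 𝔞 + 𝔟`,
`dim_ℚ 𝔞 = dim_ℚ 𝔟 = 3`, neither inside `End_Hdg(H¹X)`.  Then `X` is isogenous to `B₁^{a+1} × B₂^{b+1}` with `B₁`, `B₂`
SIMPLE, NOT of CM type, `0 < dim Bᵢ ≤ 2`, `dim_ℚ End⁰(Bᵢ) = (dim Bᵢ)²`, `Z(End⁰ Bᵢ) = ℚ` (non-CM elliptic curves or quaternion
surfaces), `Hom(B₁, B₂) = 0 = Hom(B₂, B₁)` — in particular `B₁ ≁ B₂` —, `(a+1) dim B₁ + (b+1) dim B₂ = dim X`,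
`dim MT(H¹X) = 7`, and `X` is NOT of CM type.  PROOF: `exists_splitting_of_ideal_pair` (`X ∼ Y ⊞ Z`,
`dim MT(H¹Y) = dim MT(H¹Z) = 4`, both non-CM), the rung `dim MT ≤ 4` (`exists_isIsogenous_power_of_not_isOfCMType`,
`dim_le_two_of_finrank_endAlgebra_eq_sq`) for `Y` and `Z`, §1 for orthogonality, and `dim MT(H¹X) = dim(𝔞 ⊕ 𝔟) + 1`.
[cite: MoonenZarhin1999LowDim, §2 (2.1)–(2.5), §3 (3.1) and Cor. (3.7)] [cite: MumfordAV1970, §19 Cor. 1–2 (pp. 173–174)]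
[cite: Deligne1982HodgeCycles, I §3 Prop. 3.4 and §5 Prop. 5.1] -/
theorem exists_isIsogenous_powSucc_prod_powSucc_of_ideal_pair (hX : IsSmoothProjective n X.X)
    {𝔞 𝔟 : Submodule ℚ (Module.End ℚ (bettiCohomology X.X 1))}
    (h𝔞 : haveI := BettiUniverse.finite hX 1
      𝔞 ≤ (BettiUniverse.hodge exists_isReal_hodgeModel_holds hX 1).hodgeLie)
    (h𝔟 : haveI := BettiUniverse.finite hX 1
      𝔟 ≤ (BettiUniverse.hodge exists_isReal_hodgeModel_holds hX 1).hodgeLie)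
    (hI𝔞 : haveI := BettiUniverse.finite hX 1
      ∀ W ∈ (BettiUniverse.hodge exists_isReal_hodgeModel_holds hX 1).hodgeLie, ∀ a ∈ 𝔞, W * a - a * W ∈ 𝔞)
    (hI𝔟 : haveI := BettiUniverse.finite hX 1
      ∀ W ∈ (BettiUniverse.hodge exists_isReal_hodgeModel_holds hX 1).hodgeLie, ∀ b ∈ 𝔟, W * b - b * W ∈ 𝔟)
    (hcomm : ∀ a ∈ 𝔞, ∀ b ∈ 𝔟, a * b = b * a)
    (hsum : haveI := BettiUniverse.finite hX 1
      (BettiUniverse.hodge exists_isReal_hodgeModel_holds hX 1).hodgeLie ≤ 𝔞 ⊔ 𝔟)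
    (h3𝔞 : Module.finrank ℚ 𝔞 = 3) (h3𝔟 : Module.finrank ℚ 𝔟 = 3)
    (hne𝔞 : haveI := BettiUniverse.finite hX 1
      ¬ 𝔞 ≤ Subalgebra.toSubmodule (BettiUniverse.hodge exists_isReal_hodgeModel_holds hX 1).endAlg)
    (hne𝔟 : haveI := BettiUniverse.finite hX 1
      ¬ 𝔟 ≤ Subalgebra.toSubmodule (BettiUniverse.hodge exists_isReal_hodgeModel_holds hX 1).endAlg) :
    haveI := BettiUniverse.finite hX 1
    ∃ (B₁ B₂ : AbelianVariety ℂ) (a b : ℕ), B₁.IsSimple ∧ B₂.IsSimple ∧ 0 < B₁.dim ∧ B₁.dim ≤ 2 ∧ 0 < B₂.dim ∧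
      B₂.dim ≤ 2 ∧ ¬ IsOfCMType B₁ ∧ ¬ IsOfCMType B₂ ∧
      Module.finrank ℚ B₁.endAlgebra = B₁.dim ^ 2 ∧ Module.finrank ℚ (Subalgebra.center ℚ B₁.endAlgebra) = 1 ∧
      Module.finrank ℚ B₂.endAlgebra = B₂.dim ^ 2 ∧ Module.finrank ℚ (Subalgebra.center ℚ B₂.endAlgebra) = 1 ∧
      (∀ f : B₁ ⟶ B₂, f = 0) ∧ (∀ f : B₂ ⟶ B₁, f = 0) ∧ ¬ IsIsogenous B₁ B₂ ∧
      IsIsogenous X ((B₁.powSucc a).prod (B₂.powSucc b)) ∧ (a + 1) * B₁.dim + (b + 1) * B₂.dim = X.dim ∧ 0 < X.dim ∧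
      ¬ IsOfCMType X ∧ (BettiUniverse.hodge exists_isReal_hodgeModel_holds hX 1).mtRank = 7 ∧
      Module.finrank ℚ (BettiUniverse.hodge exists_isReal_hodgeModel_holds hX 1).hodgeLie = 6 := by
  have hn : X.dim = n := schemeDim_eq_holds hX
  subst hn
  haveI := BettiUniverse.finite hX 1
  have hZsp : ∀ A : AbelianVariety ℂ, IsSmoothProjective A.dim A.X := fun A => AbelianVariety.isSmoothProjective_holds
  obtain ⟨e, M, F, Y, Z, h, i, t, j, hec, hee, he0, he1, hM, hap, hbp, hFe, hFrep, hhi, hih, hjt, hit, hjh, hsumF, hiso,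
    hdimYZ, hY0, hZ0, hYcm, hZcm, hLieY, hLieZ, hmtY, hmtZ, -, -, -, -⟩ :=
    exists_splitting_of_ideal_pair hX h𝔞 h𝔟 hI𝔞 hI𝔟 hcomm hsum h3𝔞 h3𝔟 hne𝔞 hne𝔟
  haveI := BettiUniverse.finite (hZsp Y) 1
  haveI := BettiUniverse.finite (hZsp Z) 1
  -- the rung `dim MT ≤ 4` for `Y` and `Z`
  obtain ⟨B₁, a, hB₁s, hB₁0, hB₁cm, hYB, hdimY, hfinB₁, hZB₁⟩ :=
    exists_isIsogenous_power_of_not_isOfCMType (hZsp Y) hY0 hYcm hmtY.le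
  obtain ⟨B₂, b, hB₂s, hB₂0, hB₂cm, hZB, hdimZ, hfinB₂, hZB₂⟩ :=
    exists_isIsogenous_power_of_not_isOfCMType (hZsp Z) hZ0 hZcm hmtZ.le
  have hB₁2 : B₁.dim ≤ 2 := dim_le_two_of_finrank_endAlgebra_eq_sq hB₁s hB₁0 hfinB₁
  have hB₂2 : B₂.dim ≤ 2 := dim_le_two_of_finrank_endAlgebra_eq_sq hB₂s hB₂0 hfinB₂
  -- orthogonality
  obtain ⟨hYZ, hZY⟩ := hom_eq_zero_of_central_splitting hec hM hFe hhi hih hjt hit hjh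
  have h12 : ∀ f : B₁ ⟶ B₂, f = 0 :=
    forall_hom_eq_zero_of_biproduct (0 : Fin (a + 1)) (0 : Fin (b + 1)) (forall_hom_eq_zero_of_isIsogenous hYZ hYB hZB)
  have h21 : ∀ f : B₂ ⟶ B₁, f = 0 :=
    forall_hom_eq_zero_of_biproduct (0 : Fin (b + 1)) (0 : Fin (a + 1)) (forall_hom_eq_zero_of_isIsogenous hZY hZB hYB)
  have hniso : ¬ IsIsogenous B₁ B₂ := by
    rintro ⟨u, hu⟩
    exact not_isIsogeny_zero_of_dim_pos hB₂0 ((h12 u) ▸ hu)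
  -- `X ∼ B₁^{a+1} × B₂^{b+1}`
  have hXB : IsIsogenous X ((B₁.powSucc a).prod (B₂.powSucc b)) := by
    have h1' : IsIsogenous (Y ⊞ Z) X := ⟨_, hiso⟩
    have h2' : IsIsogenous (Y ⊞ Z) (Y.prod Z) := ⟨(biprodIsoProd Y Z).hom, isIsogeny_hom_of_iso _⟩
    have h3' : IsIsogenous (Y.prod Z) ((B₁.powSucc a).prod (B₂.powSucc b)) :=
      (hYB.trans (isIsogenous_biproduct_powSucc B₁ a)).prod (hZB.trans (isIsogenous_biproduct_powSucc B₂ b))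
    exact h1'.symm'.trans (h2'.trans h3')
  -- `X` is not of CM type
  have hcm : ¬ IsOfCMType X := by
    intro hX'
    have hYZ' : IsOfCMType (Y ⊞ Z) := (isOfCMType_iff_of_isIsogenous ⟨biprod.desc i j, hiso⟩).2 hX'
    exact hYcm (isOfCMType_biprod_iff.1 hYZ').1
  -- `dim Lie Hg(H¹X) = 6`, `dim MT(H¹X) = 7`
  set H := BettiUniverse.hodge exists_isReal_hodgeModel_holds hX 1 with hH
  have hinf : 𝔞 ⊓ 𝔟 = ⊥ := by
    rw [Submodule.eq_bot_iff]
    intro z hz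
    obtain ⟨hza, hzb⟩ := Submodule.mem_inf.1 hz
    rw [← (hap z hza).1, (hbp z hzb).1]
  have h𝔥 : H.hodgeLie = 𝔞 ⊔ 𝔟 := le_antisymm hsum (sup_le h𝔞 h𝔟)
  have hLie : Module.finrank ℚ H.hodgeLie = 6 := by
    have h := Submodule.finrank_sup_add_finrank_inf_eq 𝔞 𝔟
    rw [hinf, finrank_bot, add_zero, h3𝔞, h3𝔟, ← h𝔥] at h
    omega
  have hX0 : 0 < X.dim := by omega
  have hmt : H.mtRank = 7 := by rw [hH, mtRank_hodge_one_eq_finrank_hodgeLie_add_one hX hX0, ← hH, hLie]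
  refine ⟨B₁, B₂, a, b, hB₁s, hB₂s, hB₁0, hB₁2, hB₂0, hB₂2, hB₁cm, hB₂cm, hfinB₁, hZB₁, hfinB₂, hZB₂, h12, h21, hniso, hXB,
    ?_, hX0, hcm, hmt, hLie⟩
  rw [← hdimY, ← hdimZ, hdimYZ]

end Summit.HodgeConjecture.CorCM

end
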